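import Summits.QuantumFields.YangMills.Theorems.LuscherReductionTwistedTraceScalingBOCurrencyFloorZ
import Summits.QuantumFields.YangMills.Theorems.FlatTubeReductionRecordNormFloor
import Summits.QuantumFields.YangMills.Theorems.FlatTubeReductionGaussProfileNumbers
import HarnessLib

/-!
# The absolute currency floors at the rate twin's scales `(s, K_c) = (1/6, 42D+1)`

Support file for the crux `NearFlatRatioLaw` (line `ratepack_v2`, stub `stub_hODpot_A`; successor step (E3) of memo v8 (g19) /
`Cruxes/NearFlatRatioLaw/Lines/ratepack-v7-moments-g18.md` §14): lane A's `…BOCurrencyFloor.currency_floor` and `…BOCurrencyFloorZ.currency_floor_inv` VERBATIM except that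
the norm floor is the rate twin's `…RecordNormFloor.tubeNormSq_record_ge_R` (weight `recordChi L (1/6) (42D+1) M β`, amplitude window `orbitDist < D·recordDelta1 L (1/6) β`, floor
`½γ` directly) and the statement is written with `recordProfile`, `btEps`: `c_R·(β^{-1})^K·((e^{2β})^{|E|})²·[fpZ^{-2}]·∫φ² ≤ Λ_A(β)²·T(φ⊗Ω_c)` eventually — the polynomial floors against which
the super-polynomially small non-core pieces (FP tail, outer region, dual-BO shell) of `stub_hODpot_A` are `O(bareLambda²)` (`…DefectRatesSq`).
* ★★ `currency_floor_R`, ★★ `currency_floor_inv_R`.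
-/

set_option autoImplicit false

noncomputable section

open MeasureTheory Filter Topology Real
open scoped BigOperators
open Literature.MathematicalPhysics.QuantumFieldTheory
open Literature.MathematicalPhysics.QuantumLattice

namespace Summit.QuantumFields.YangMills.Theorems.FemtoTransferGap.TwoLattice.ConstTube

open Summit.QuantumFields.YangMills.Theorems.FemtoTransferGap
open Summit.QuantumFields.YangMills.Theorems.FemtoTransferGap.TwoLattice
open Summit.QuantumFields.YangMills.Theorems.FemtoTransferGap.TwoLattice.Avg
open Summit.QuantumFields.YangMills.Theorems.FemtoTransferGap.TwoLattice.Stiff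
open Summit.QuantumFields.YangMills.Theorems.FemtoTransferGap.RateTube

variable {L : ℕ} [NeZero L]

set_option maxHeartbeats 800000 in
-- long record expressions.
/-- ★★ **THE ABSOLUTE CURRENCY FLOOR AT THE RATE TWIN'S SCALES**: `∃ M₀ ≥ 2, ∀ M ≥ M₀, ∃ c_R > 0, ∃ K, ∀ᶠ β, ∀ φ` (measurable, bounded, supported in
`orbitDist < D·recordDelta1 L (1/6) β`): `c_R·(β^{-1})^K·((e^{2β})^{|E|})²·∫φ² ≤ Λ_A(β)²·T(φ⊗Ω_c)` (weight `recordChi L (1/6) (42D+1) M β`). [cite: Luscher1983, §3] -/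
theorem currency_floor_R (hLz : Nonempty (NzSite L)) {D : ℝ} (hD0 : 0 ≤ D) :
    ∃ M₀ : ℝ, 2 ≤ M₀ ∧ ∀ M : ℝ, M₀ ≤ M → ∃ (cR : ℝ) (K : ℕ), 0 < cR ∧ ∀ᶠ β : ℝ in atTop,
      ∀ φ : GaugeConfig 3 1 SU2 → ℝ, Measurable φ → ∀ Cφ : ℝ, (∀ u, |φ u| ≤ Cφ) → (∀ u, φ u ≠ 0 → orbitDist u < D * recordDelta1 L (1 / 6) β) →
      cR * powScale 1 β ^ K * (Real.exp (2 * β) ^ Fintype.card (Edge 3 L)) ^ 2 * ∫ u, φ u ^ 2 ∂configMeasure SU2 1 ≤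
        (btC L β (recordProfile L β) (btEps β) (5 * (powScale (1 / 2) β * btLog β ^ 2)) / fpZ (btEps β) / recordGamma L (recordProfile L) β * levelValue su2Rep 1 ((L : ℝ) ^ 3 * β) 0) ^ 2 * tubeNormSq (softWeight (recordChi L (1 / 6) (42 * D + 1) M β)) (boFun L φ (recordProfile L β)) := by
  haveI := isFiniteMeasure_orthoTransverse L
  obtain ⟨M₀, hM₀, hnorm⟩ := tubeNormSq_record_ge_R (L := L) hLz hD0
  refine ⟨M₀, hM₀, fun M hM => ?_⟩
  have hn := hnorm M hM
  obtain ⟨C₁, K₁, hC₁, hbtC⟩ := btC_record_poly_floor (L := L)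
  set G : ℝ := fpWeightBar L 1 * (orthoTransverse L).real Set.univ + 1 with hGdef
  have hG0 : 0 < G := by
    have : 0 ≤ fpWeightBar L 1 * (orthoTransverse L).real Set.univ := mul_nonneg (fpWeightBar_pos L one_pos).le measureReal_nonneg
    rw [hGdef]; linarith
  have hL1 : (1 : ℝ) ≤ L := by exact_mod_cast NeZero.one_le
  have hL3 : (1 : ℝ) ≤ (L : ℝ) ^ 3 := one_le_pow₀ hL1
  refine ⟨C₁ ^ 2 * (Real.exp (-3) / 2000) ^ 2 / ((L : ℝ) ^ 3) ^ 9 / (2 * G), 2 * K₁ + 9, by positivity, ?_⟩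
  have hrs := rStar_pos
  filter_upwards [hn, hbtC, eventually_ge_atTop (1 : ℝ), eventually_ge_atTop (2 / rStar ^ 3)] with β hnβ hbtCβ' hβ1 hβr φ hφm Cφ hCφ hφs
  have hβ0 : 0 ≤ β := by linarith
  have hbtCβ : C₁ * powScale 1 β ^ K₁ ≤ btC L β (recordProfile L β) (btEps β) (5 * (powScale (1 / 2) β * btLog β ^ 2)) := hbtCβ'
  -- the data
  set B : ℝ := (L : ℝ) ^ 3 * β with hBdef
  have hB1 : 1 ≤ B := by rw [hBdef]; nlinarith
  have hB2 : 2 / rStar ^ 3 ≤ B := by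
    rw [hBdef]; have : 0 ≤ 2 / rStar ^ 3 := by positivity
    nlinarith
  have hB0 : 0 < B := by linarith
  have hlam := levelValue_one_site_zero_ge hB1 hB2
  have hZ0 : 0 < fpZ (btEps β) := fpZ_pos (powScale_pos 1 β)
  have hZ1 : fpZ (btEps β) ≤ 1 := fpZ_le_one (powScale 1 β)
  have hγ0 : 0 < recordGamma L (recordProfile L) β := recordGamma_recordProfile_pos L hβ0
  have hγG : recordGamma L (recordProfile L) β ≤ G := by
    have h : recordGamma L (recordProfile L) β ≤ fpWeightBar L 1 * (orthoTransverse L).real Set.univ := recordGamma_le_fpWeightBar_one (L := L) β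
    rw [hGdef]; linarith
  have hI : 0 ≤ ∫ u, φ u ^ 2 ∂configMeasure SU2 1 := integral_nonneg fun u => sq_nonneg _
  have hT : 1 / 2 * recordGamma L (recordProfile L) β * ∫ u, φ u ^ 2 ∂configMeasure SU2 1 ≤ tubeNormSq (softWeight (recordChi L (1 / 6) (42 * D + 1) M β)) (boFun L φ (recordProfile L β)) := hnβ φ hφm Cφ hCφ hφs
  have hps1 : powScale 1 β = β⁻¹ := by rw [powScale_eq hβ1, Real.rpow_neg_one]
  have hlamF0 : 0 ≤ Real.exp (6 * B) * (Real.exp (-3) * B ^ (-(9 : ℝ) / 2) / 2000) :=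
    mul_nonneg (Real.exp_pos _).le (div_nonneg (mul_nonneg (Real.exp_pos _).le (Real.rpow_nonneg hB0.le _)) (by norm_num))
  have hC₁K : 0 ≤ C₁ * powScale 1 β ^ K₁ := mul_nonneg hC₁.le (pow_nonneg (powScale_pos 1 β).le _)
  have key := currency_floor_alg hC₁K hbtCβ hlamF0 hlam hZ0 hZ1 hγ0 hγG hI hT
  have hBpow : (B ^ (-(9 : ℝ) / 2)) ^ 2 = powScale 1 β ^ 9 / ((L : ℝ) ^ 3) ^ 9 := by
    rw [← Real.rpow_natCast, ← Real.rpow_mul hB0.le]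
    norm_num
    rw [hps1, hBdef]
    field_simp
  have hE : Real.exp (6 * B) = Real.exp (2 * β) ^ Fintype.card (Edge 3 L) := by rw [exp_two_pow_card_edge]
  have hlhs : C₁ ^ 2 * (Real.exp (-3) / 2000) ^ 2 / ((L : ℝ) ^ 3) ^ 9 / (2 * G) * powScale 1 β ^ (2 * K₁ + 9) * (Real.exp (2 * β) ^ Fintype.card (Edge 3 L)) ^ 2 *
        ∫ u, φ u ^ 2 ∂configMeasure SU2 1 =
      (C₁ * powScale 1 β ^ K₁) ^ 2 * (Real.exp (6 * B) * (Real.exp (-3) * B ^ (-(9 : ℝ) / 2) / 2000)) ^ 2 / (2 * G) * ∫ u, φ u ^ 2 ∂configMeasure SU2 1 := by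
    have e1 : (Real.exp (6 * B) * (Real.exp (-3) * B ^ (-(9 : ℝ) / 2) / 2000)) ^ 2 =
        (Real.exp (2 * β) ^ Fintype.card (Edge 3 L)) ^ 2 * (Real.exp (-3) / 2000) ^ 2 * (B ^ (-(9 : ℝ) / 2)) ^ 2 := by rw [hE]; ring
    rw [e1, hBpow, pow_add, pow_mul]
    field_simp
    ring
  rw [hlhs]
  exact key

set_option maxHeartbeats 800000 in
-- long record expressions.
/-- ★★ **THE ABSOLUTE CURRENCY FLOOR WITH `fpZ⁻²` KEPT, AT THE RATE TWIN'S SCALES.** [cite: Luscher1983, §3] -/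
theorem currency_floor_inv_R (hLz : Nonempty (NzSite L)) {D : ℝ} (hD0 : 0 ≤ D) :
    ∃ M₀ : ℝ, 2 ≤ M₀ ∧ ∀ M : ℝ, M₀ ≤ M → ∃ (cR : ℝ) (K : ℕ), 0 < cR ∧ ∀ᶠ β : ℝ in atTop,
      ∀ φ : GaugeConfig 3 1 SU2 → ℝ, Measurable φ → ∀ Cφ : ℝ, (∀ u, |φ u| ≤ Cφ) → (∀ u, φ u ≠ 0 → orbitDist u < D * recordDelta1 L (1 / 6) β) →
      cR * powScale 1 β ^ K * (Real.exp (2 * β) ^ Fintype.card (Edge 3 L)) ^ 2 * (fpZ (powScale 1 β))⁻¹ ^ 2 * ∫ u, φ u ^ 2 ∂configMeasure SU2 1 ≤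
        (btC L β (recordProfile L β) (btEps β) (5 * (powScale (1 / 2) β * btLog β ^ 2)) / fpZ (btEps β) / recordGamma L (recordProfile L) β * levelValue su2Rep 1 ((L : ℝ) ^ 3 * β) 0) ^ 2 * tubeNormSq (softWeight (recordChi L (1 / 6) (42 * D + 1) M β)) (boFun L φ (recordProfile L β)) := by
  haveI := isFiniteMeasure_orthoTransverse L
  obtain ⟨M₀, hM₀, hnorm⟩ := tubeNormSq_record_ge_R (L := L) hLz hD0
  refine ⟨M₀, hM₀, fun M hM => ?_⟩
  have hn := hnorm M hM
  obtain ⟨C₁, K₁, hC₁, hbtC⟩ := btC_record_poly_floor (L := L)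
  set G : ℝ := fpWeightBar L 1 * (orthoTransverse L).real Set.univ + 1 with hGdef
  have hG0 : 0 < G := by
    have : 0 ≤ fpWeightBar L 1 * (orthoTransverse L).real Set.univ := mul_nonneg (fpWeightBar_pos L one_pos).le measureReal_nonneg
    rw [hGdef]; linarith
  have hL1 : (1 : ℝ) ≤ L := by exact_mod_cast NeZero.one_le
  have hL3 : (1 : ℝ) ≤ (L : ℝ) ^ 3 := one_le_pow₀ hL1
  refine ⟨C₁ ^ 2 * (Real.exp (-3) / 2000) ^ 2 / ((L : ℝ) ^ 3) ^ 9 / (2 * G), 2 * K₁ + 9, by positivity, ?_⟩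
  have hrs := rStar_pos
  filter_upwards [hn, hbtC, eventually_ge_atTop (1 : ℝ), eventually_ge_atTop (2 / rStar ^ 3)] with β hnβ hbtCβ' hβ1 hβr φ hφm Cφ hCφ hφs
  have hβ0 : 0 ≤ β := by linarith
  have hbtCβ : C₁ * powScale 1 β ^ K₁ ≤ btC L β (recordProfile L β) (btEps β) (5 * (powScale (1 / 2) β * btLog β ^ 2)) := hbtCβ'
  -- the data
  set B : ℝ := (L : ℝ) ^ 3 * β with hBdef
  have hB1 : 1 ≤ B := by rw [hBdef]; nlinarith
  have hB2 : 2 / rStar ^ 3 ≤ B := by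
    rw [hBdef]; have : 0 ≤ 2 / rStar ^ 3 := by positivity
    nlinarith
  have hB0 : 0 < B := by linarith
  have hlam := levelValue_one_site_zero_ge hB1 hB2
  have hZ0 : 0 < fpZ (btEps β) := fpZ_pos (powScale_pos 1 β)
  have hZ1 : fpZ (btEps β) ≤ 1 := fpZ_le_one (powScale 1 β)
  have hγ0 : 0 < recordGamma L (recordProfile L) β := recordGamma_recordProfile_pos L hβ0
  have hγG : recordGamma L (recordProfile L) β ≤ G := by
    have h : recordGamma L (recordProfile L) β ≤ fpWeightBar L 1 * (orthoTransverse L).real Set.univ := recordGamma_le_fpWeightBar_one (L := L) β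
    rw [hGdef]; linarith
  have hI : 0 ≤ ∫ u, φ u ^ 2 ∂configMeasure SU2 1 := integral_nonneg fun u => sq_nonneg _
  have hT : 1 / 2 * recordGamma L (recordProfile L) β * ∫ u, φ u ^ 2 ∂configMeasure SU2 1 ≤ tubeNormSq (softWeight (recordChi L (1 / 6) (42 * D + 1) M β)) (boFun L φ (recordProfile L β)) := hnβ φ hφm Cφ hCφ hφs
  have hps1 : powScale 1 β = β⁻¹ := by rw [powScale_eq hβ1, Real.rpow_neg_one]
  have hlamF0 : 0 ≤ Real.exp (6 * B) * (Real.exp (-3) * B ^ (-(9 : ℝ) / 2) / 2000) :=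
    mul_nonneg (Real.exp_pos _).le (div_nonneg (mul_nonneg (Real.exp_pos _).le (Real.rpow_nonneg hB0.le _)) (by norm_num))
  have hC₁K : 0 ≤ C₁ * powScale 1 β ^ K₁ := mul_nonneg hC₁.le (pow_nonneg (powScale_pos 1 β).le _)
  have key := currency_floor_alg_inv hC₁K hbtCβ hlamF0 hlam hZ0 hγ0 hγG hI hT
  have hBpow : (B ^ (-(9 : ℝ) / 2)) ^ 2 = powScale 1 β ^ 9 / ((L : ℝ) ^ 3) ^ 9 := by
    rw [← Real.rpow_natCast, ← Real.rpow_mul hB0.le]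
    norm_num
    rw [hps1, hBdef]
    field_simp
  have hE : Real.exp (6 * B) = Real.exp (2 * β) ^ Fintype.card (Edge 3 L) := by rw [exp_two_pow_card_edge]
  have hlhs : C₁ ^ 2 * (Real.exp (-3) / 2000) ^ 2 / ((L : ℝ) ^ 3) ^ 9 / (2 * G) * powScale 1 β ^ (2 * K₁ + 9) * (Real.exp (2 * β) ^ Fintype.card (Edge 3 L)) ^ 2 *
        (fpZ (powScale 1 β))⁻¹ ^ 2 * ∫ u, φ u ^ 2 ∂configMeasure SU2 1 =
      (C₁ * powScale 1 β ^ K₁) ^ 2 * (Real.exp (6 * B) * (Real.exp (-3) * B ^ (-(9 : ℝ) / 2) / 2000)) ^ 2 / (2 * G) * (fpZ (btEps β))⁻¹ ^ 2 * ∫ u, φ u ^ 2 ∂configMeasure SU2 1 := by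
    have e1 : (Real.exp (6 * B) * (Real.exp (-3) * B ^ (-(9 : ℝ) / 2) / 2000)) ^ 2 =
        (Real.exp (2 * β) ^ Fintype.card (Edge 3 L)) ^ 2 * (Real.exp (-3) / 2000) ^ 2 * (B ^ (-(9 : ℝ) / 2)) ^ 2 := by rw [hE]; ring
    rw [e1, hBpow, pow_add, pow_mul]
    unfold btEps
    field_simp
    ring
  rw [hlhs]
  exact key

end Summit.QuantumFields.YangMills.Theorems.FemtoTransferGap.TwoLattice.ConstTube

end
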